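import Summits.Ventures.CertifiedManyBodySolver.Observables.NeelClassFloorFourthMoment
import HarnessLib

/-!
# Ventures/CertifiedManyBodySolver — Observables/NeelClassFloorSixthMoment.lean
# The SIXTH band moment `Σ_k ε_k⁶ = 400t⁶L²` on the torus (`L ≥ 7`): the `400 = C(6,3)²` closed six-step walks on `ℤ²`

HONEST FRAMING: first certified bounds; not a superconductivity verdict; every number certified or labelled float.

Cell `hubbard-tc` (MO-S3), seat `hubbard-tc-mod-3` (G3), `prover-hubbard-tc-mod-3-g7-0`. Successor infrastructure for CUBIC majorants of
`√(x + Δ²)` in the SDW-reference floor (`NeelClassFloorQuad.lean` uses quadratic majorants and `Σε⁴ = 36L²`; a cubic majorant read by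
`Σε⁶ = 400L²` recovers a further ≈ 60–90 % of the residual Jensen loss — designer `g7-replay/moment6.py` [float]). Same character proof as
`sum_siteBand_pow_four`: `(Σ_s χ_k(s))⁶ = Σ_{six-step walks} χ_k(endpoint)`, orthogonality, and for `L ≥ 7` a six-step walk closes on the torus
iff it closes on `ℤ²` (`400` of the `4⁶` walks, `decide`). Everything is PROVED; no definition, no `sorry`.
References: S. Friedli, Y. Velenik (2017) §10.4 [FriedliVelenik2017]; J. S. Langer, D. C. Mattis (1971) eq. (3) [LangerMattis1971].
-/

noncomputable section

namespace Summit.Ventures.CertifiedManyBodySolver.Observables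

namespace NeelClassFloor

open Literature.MathematicalPhysics.QuantumLattice

open Matrix Finset Literature.Probability.LatticeModels
  Literature.MathematicalPhysics.QuantumLattice.LangerMattis
  Literature.MathematicalPhysics.QuantumLattice.HartreeFock
open scoped ComplexOrder ComplexConjugate

variable {L : ℕ}

section SixthMoment

variable [NeZero L]

/-- `Π_{l<6} χ_k(s_l) = χ_k(s₀ + ⋯ + s₅)`. [cite: FriedliVelenik2017, §10.4] -/
theorem prod_torusChar_six (k : TorusSite 2 L) (s : Fin 6 → TorusSite 2 L) :
    ∏ l : Fin 6, torusChar k (s l) = torusChar k (∑ l : Fin 6, s l) := by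
  rw [Fin.prod_univ_six, Fin.sum_univ_six, torusChar_add_right, torusChar_add_right, torusChar_add_right,
    torusChar_add_right, torusChar_add_right]

omit [NeZero L] in
/-- A six-step walk on `(ℤ/Lℤ)²`, `L ≥ 7`, closes iff it closes on `ℤ²`. [cite: FriedliVelenik2017, §10.4] -/
theorem step_sum_six_eq_zero_iff (hL : 7 ≤ L) (p : Fin 6 → Fin 4) :
    (∑ l : Fin 6, ((![Pi.single 0 1, -(Pi.single 0 1), Pi.single 1 1, -(Pi.single 1 1)] :
        Fin 4 → TorusSite 2 L) (p l))) = 0 ↔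
      (∑ l : Fin 6, (![1, -1, 0, 0] : Fin 4 → ℤ) (p l) = 0 ∧ ∑ l : Fin 6, (![0, 0, 1, -1] : Fin 4 → ℤ) (p l) = 0) := by
  have hcoord : ∀ j : Fin 4, ((![Pi.single 0 1, -(Pi.single 0 1), Pi.single 1 1, -(Pi.single 1 1)] :
        Fin 4 → TorusSite 2 L) j) = fun i : Fin 2 =>
          (((![![1, -1, 0, 0], ![0, 0, 1, -1]] : Fin 2 → Fin 4 → ℤ) i j : ℤ) : ZMod L) := by
    intro j
    funext i
    fin_cases j <;> fin_cases i <;> simp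
  have hsmall : ∀ (c : Fin 4 → ℤ), (∀ j, c j = 1 ∨ c j = -1 ∨ c j = 0) →
      ((((∑ l : Fin 6, c (p l) : ℤ)) : ZMod L) = 0 ↔ ∑ l : Fin 6, c (p l) = 0) := by
    intro c hc
    constructor
    · intro h
      rw [ZMod.intCast_zmod_eq_zero_iff_dvd] at h
      refine Int.eq_zero_of_dvd_of_natAbs_lt_natAbs h ?_
      have hb : (∑ l : Fin 6, c (p l)).natAbs ≤ 6 := by
        have h1 : ∀ l : Fin 6, (c (p l)).natAbs ≤ 1 := by
          intro l
          rcases hc (p l) with h | h | h <;> simp [h]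
        calc (∑ l : Fin 6, c (p l)).natAbs ≤ ∑ l : Fin 6, (c (p l)).natAbs := Int.natAbs_sum_le _ _
          _ ≤ ∑ _l : Fin 6, 1 := Finset.sum_le_sum fun l _ => h1 l
          _ = 6 := by simp
      have : (L : ℤ).natAbs = L := Int.natAbs_natCast L
      omega
    · intro h
      rw [h, Int.cast_zero]
  simp_rw [hcoord]
  rw [funext_iff]
  simp only [Finset.sum_apply, Pi.zero_apply, Fin.forall_fin_two]
  simp only [Matrix.cons_val_zero, Matrix.cons_val_one]
  rw [← Int.cast_sum, ← Int.cast_sum, hsmall _ (by intro j; fin_cases j <;> simp),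
    hsmall _ (by intro j; fin_cases j <;> simp)]

/-- The number of closed six-step walks on `ℤ²` is `400 = C(6,3)²`. [cite: FriedliVelenik2017, §10.4] -/
theorem card_closed_six_walks :
    (Finset.univ.filter (fun p : Fin 6 → Fin 4 =>
      ∑ l : Fin 6, (![1, -1, 0, 0] : Fin 4 → ℤ) (p l) = 0 ∧ ∑ l : Fin 6, (![0, 0, 1, -1] : Fin 4 → ℤ) (p l) = 0)).card = 400 := by
  decide +kernel

/-- **The sixth band moment**: `Σ_k ε_t(k)⁶ = 400 t⁶ L²` on `(ℤ/Lℤ)²`, `L ≥ 7`. [cite: FriedliVelenik2017, §10.4] -/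
theorem sum_siteBand_pow_six (hL : 7 ≤ L) (t : ℝ) :
    ∑ k : FermionTorus 2 L, siteBand t k ^ 6 = 400 * t ^ 6 * (L : ℝ) ^ 2 := by
  classical
  set s : Fin 4 → TorusSite 2 L := ![Pi.single 0 1, -(Pi.single 0 1), Pi.single 1 1, -(Pi.single 1 1)] with hs
  have hL2 : 2 ≤ L := by omega
  have hC : ∀ k : FermionTorus 2 L, (((siteBand t k ^ 6 : ℝ)) : ℂ) =
      (t : ℂ) ^ 6 * ∑ p : Fin 6 → Fin 4, torusChar k.toTorusSite (∑ l, s (p l)) := by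
    intro k
    push_cast
    rw [siteBand_eq_sum_torusChar hL2 t k, mul_pow]
    congr 1
    rw [← hs]
    have h := (Finset.prod_univ_sum (fun (_ : Fin 6) => (Finset.univ : Finset (Fin 4)))
      (fun _ j => torusChar k.toTorusSite (s j)))
    rw [Finset.prod_const, Finset.card_univ, Fintype.card_fin, Fintype.piFinset_univ] at h
    rw [h]
    refine Finset.sum_congr rfl fun p _ => ?_
    exact prod_torusChar_six _ _
  have hsum : ∑ k : FermionTorus 2 L, (((siteBand t k ^ 6 : ℝ)) : ℂ) = ((400 * t ^ 6 * (L : ℝ) ^ 2 : ℝ) : ℂ) := by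
    simp_rw [hC]
    rw [← Finset.mul_sum, FermionTorus.sum_eq_sum_torusSite]
    simp only [FermionTorus.toTorusSite_ofTorusSite]
    rw [Finset.sum_comm]
    simp_rw [sum_torusChar_left]
    simp only [hs]
    simp_rw [step_sum_six_eq_zero_iff hL]
    rw [Finset.sum_ite, Finset.sum_const_zero, add_zero, Finset.sum_const, card_closed_six_walks, nsmul_eq_mul]
    push_cast
    ring
  exact_mod_cast hsum

end SixthMoment

end NeelClassFloor

end Summit.Ventures.CertifiedManyBodySolver.Observables

end
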